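import Summits.Ventures.PercRepro.C041BlockMapMultilinear

/-!
# ROW C-041 — THEOREM (SUBDIVISION): the block map of a host with an edge subdivided is the block map of the host
plus the block map of the host with that edge turned into a loop (p6, gen 34; the mechanism of mine-3's C-041.md
§21 (a) — «a mixed arc carries both colours, so no blue run and no red run passes through it» — for every host,
every family of exits and every `r`)

Setting of `C041BlockMapMultilinear`.  For an unmarked host `Z₁` and an edge `e₀` with ends `x = fst e₀`,
`y = snd e₀`, the SUBDIVIDED host `subdiv Z₁ e₀` has the new vertex `none`, the half-edge `some e₀` from `x` to
`none` and the new half-edge `none` from `none` to `y` (every other edge `some e` keeps its ends); the LOOPIFIED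
host `loopify Z₁ e₀` has `e₀` as a loop at `x` (for connectivity: `Z₁` with `e₀` deleted, every colouring of the
loop counted).  A colouring `ω'` of the subdivided host colours the two halves `b₁ = ω' (some e₀)`, `b₂ = ω' none`:
if `b₁ = b₂` the pair acts, for both colours, exactly as the edge `e₀` coloured `b₁` (`reflTransGen_subdiv_iff`
with `H = Z₁`); if `b₁ ≠ b₂` no monochromatic path crosses the pair and the statuses are those of the loopified
host (`H = loopify Z₁ e₀`).  Hence every status of an old vertex (merged / reached / blue-connected) — so the
merged set, the blocks and the colouring term — is read off `Z₁` or `loopify Z₁ e₀` under the restricted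
colouring `ω' ∘ some` (`colTerm_subdiv_agree`, `colTerm_subdiv_disagree`), and summing over the colour of the new
half-edge: **`blockMap_subdiv`: `blockMap (subdiv Z₁ e₀) (some ∘ u) (some a₁) w = blockMap Z₁ u a₁ w +
blockMap (loopify Z₁ e₀) u a₁ w`**.  COROLLARY: the cone conjecture for block maps is closed under subdivision
(`inCone_blockMap_subdiv`): if the block maps of `Z₁` and of `loopify Z₁ e₀` send a family into the cone, so
does the block map of the subdivided host — every two-exit cycle from the triangle and its loopified forms, and in
general every host from the hosts without non-terminal vertices of degree two.
-/

namespace PercRepro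

namespace ZoneZ

namespace MultiExit

open ZoneData Pendant Finset TwoExit TreeClosure

variable {V₁ E₁ U₁ U₂ : Type} (Z₁ : ZoneData V₁ E₁ U₁ U₂) (e₀ : E₁) [DecidableEq E₁]

/-! ## The loopified and the subdivided hosts -/

/-- The host with the edge `e₀` turned into a LOOP at its first end. -/
def loopify : ZoneData V₁ E₁ U₁ U₂ :=
  { Z₁ with snd := Function.update Z₁.snd e₀ (Z₁.fst e₀) }

/-- The host with the edge `e₀` SUBDIVIDED by the new vertex `none`: `some e₀` joins `fst e₀` to `none`, the new
edge `none` joins `none` to `snd e₀`, every other edge `some e` keeps its ends. -/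
def subdiv : ZoneData (Option V₁) (Option E₁) U₁ U₂ where
  fst := fun e => match e with
    | some e => some (Z₁.fst e)
    | none => none
  snd := fun e => match e with
    | some e => if e = e₀ then none else some (Z₁.snd e)
    | none => some (Z₁.snd e₀)
  at₁ := fun t => some (Z₁.at₁ t)
  at₂ := fun t => some (Z₁.at₂ t)

/-- The first end of an old edge. -/
theorem subdiv_fst_some (e : E₁) : (subdiv Z₁ e₀).fst (some e) = some (Z₁.fst e) := rfl
/-- The second end of an old edge other than `e₀`. -/
theorem subdiv_snd_some_of_ne {e : E₁} (h : e ≠ e₀) : (subdiv Z₁ e₀).snd (some e) = some (Z₁.snd e) := by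
  show (if e = e₀ then none else some (Z₁.snd e)) = _
  rw [if_neg h]
/-- The second end of the half-edge `some e₀`. -/
theorem subdiv_snd_some_self : (subdiv Z₁ e₀).snd (some e₀) = none := by
  show (if e₀ = e₀ then none else some (Z₁.snd e₀)) = _
  rw [if_pos rfl]
/-- The first end of the new half-edge. -/
theorem subdiv_fst_none : (subdiv Z₁ e₀).fst none = none := rfl
/-- The second end of the new half-edge. -/
theorem subdiv_snd_none : (subdiv Z₁ e₀).snd none = some (Z₁.snd e₀) := rfl

/-- `Joins` of an old edge other than `e₀`. -/
theorem subdiv_joins_some_of_ne {e : E₁} (h : e ≠ e₀) (z z' : Option V₁) :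
    (subdiv Z₁ e₀).Joins (some e) z z' ↔ ∃ x y, z = some x ∧ z' = some y ∧ Z₁.Joins e x y := by
  unfold Joins
  rw [subdiv_fst_some, subdiv_snd_some_of_ne Z₁ e₀ h]
  constructor
  · rintro (⟨h1, h2⟩ | ⟨h1, h2⟩)
    · exact ⟨_, _, h1.symm, h2.symm, Or.inl ⟨rfl, rfl⟩⟩
    · exact ⟨_, _, h2.symm, h1.symm, Or.inr ⟨rfl, rfl⟩⟩
  · rintro ⟨x, y, rfl, rfl, (⟨rfl, rfl⟩ | ⟨rfl, rfl⟩)⟩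
    · exact Or.inl ⟨rfl, rfl⟩
    · exact Or.inr ⟨rfl, rfl⟩

/-- `Joins` of the half-edge `some e₀`. -/
theorem subdiv_joins_some_self (z z' : Option V₁) :
    (subdiv Z₁ e₀).Joins (some e₀) z z' ↔
      (z = some (Z₁.fst e₀) ∧ z' = none) ∨ (z = none ∧ z' = some (Z₁.fst e₀)) := by
  unfold Joins
  rw [subdiv_fst_some, subdiv_snd_some_self]
  constructor
  · rintro (⟨h1, h2⟩ | ⟨h1, h2⟩)
    · exact Or.inl ⟨h1.symm, h2.symm⟩
    · exact Or.inr ⟨h2.symm, h1.symm⟩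
  · rintro (⟨rfl, rfl⟩ | ⟨rfl, rfl⟩)
    · exact Or.inl ⟨rfl, rfl⟩
    · exact Or.inr ⟨rfl, rfl⟩

/-- `Joins` of the new half-edge `none`. -/
theorem subdiv_joins_none (z z' : Option V₁) :
    (subdiv Z₁ e₀).Joins none z z' ↔
      (z = none ∧ z' = some (Z₁.snd e₀)) ∨ (z = some (Z₁.snd e₀) ∧ z' = none) := by
  unfold Joins
  rw [subdiv_fst_none, subdiv_snd_none]
  constructor
  · rintro (⟨h1, h2⟩ | ⟨h1, h2⟩)
    · exact Or.inl ⟨h1.symm, h2.symm⟩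
    · exact Or.inr ⟨h2.symm, h1.symm⟩
  · rintro (⟨rfl, rfl⟩ | ⟨rfl, rfl⟩)
    · exact Or.inl ⟨rfl, rfl⟩
    · exact Or.inr ⟨rfl, rfl⟩

/-- `Joins` in the loopified host, for an edge other than `e₀`. -/
theorem loopify_joins_of_ne {e : E₁} (h : e ≠ e₀) (x y : V₁) :
    (loopify Z₁ e₀).Joins e x y ↔ Z₁.Joins e x y := by
  unfold Joins loopify
  simp only [Function.update_of_ne h]

/-- `Joins` of the loop `e₀` in the loopified host: both ends are `fst e₀`. -/
theorem loopify_joins_self (x y : V₁) : (loopify Z₁ e₀).Joins e₀ x y → x = y := by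
  unfold Joins loopify
  simp only [Function.update_self]
  rintro (⟨rfl, rfl⟩ | ⟨rfl, rfl⟩) <;> rfl

/-! ## The reach of an old vertex in the subdivided host -/

section Reach

variable (c : Bool) (ω' : Option E₁ → Bool) (H : ZoneData V₁ E₁ U₁ U₂)

/-- **The reach of an old vertex in the subdivided host**, read off a host `H` on the old vertices that agrees with
`Z₁` off `e₀` (`hH1`), whose `e₀`-steps are trivial or, when the two halves agree in colour, steps of `Z₁` along
`e₀` (`hH2`), and which carries the edge `e₀` when the two halves agree (`hH3`): a monochromatic path of the
subdivided host between old vertices is a monochromatic path of `H` under the restricted colouring. -/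
theorem reflTransGen_subdiv_iff
    (hH1 : ∀ e, e ≠ e₀ → ∀ x y, H.Joins e x y ↔ Z₁.Joins e x y)
    (hH2 : ∀ x y, H.Joins e₀ x y → x = y ∨ (ω' (some e₀) = ω' none ∧ Z₁.Joins e₀ x y))
    (hH3 : ω' (some e₀) = ω' none → H.Joins e₀ (Z₁.fst e₀) (Z₁.snd e₀)) (v v' : V₁) :
    Relation.ReflTransGen (cAdj (subdiv Z₁ e₀) c ω') (some v) (some v') ↔
      Relation.ReflTransGen (cAdj H c fun e => ω' (some e)) v v' := by
  constructor
  · intro h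
    -- the invariant along the path
    have key : ∀ z, Relation.ReflTransGen (cAdj (subdiv Z₁ e₀) c ω') (some v) z →
        (∀ x, z = some x → Relation.ReflTransGen (cAdj H c fun e => ω' (some e)) v x) ∧
        (z = none → (ω' (some e₀) = c ∧ Relation.ReflTransGen (cAdj H c fun e => ω' (some e)) v (Z₁.fst e₀)) ∨
          (ω' none = c ∧ Relation.ReflTransGen (cAdj H c fun e => ω' (some e)) v (Z₁.snd e₀))) := by
      intro z hz
      induction hz with
      | refl =>
        refine ⟨fun x hx => ?_, fun hn => ?_⟩
        · cases hx
          exact Relation.ReflTransGen.refl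
        · exact absurd hn (Option.some_ne_none v)
      | tail hpath hstep ih =>
        rename_i z z'
        obtain ⟨e, hj, hc⟩ := hstep
        rcases e with _ | e
        · -- the new half-edge `none`, joining `none` and `some (snd e₀)`
          rw [subdiv_joins_none] at hj
          rcases hj with ⟨rfl, rfl⟩ | ⟨rfl, rfl⟩
          · refine ⟨fun x hx => ?_, fun hn => absurd hn (Option.some_ne_none _)⟩
            cases hx
            rcases ih.2 rfl with ⟨h1, hp⟩ | ⟨-, hp⟩
            · -- both halves coloured `c`: `e₀` is an edge of `H` of colour `c`
              exact hp.tail ⟨e₀, hH3 (h1.trans hc.symm), h1⟩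
            · exact hp
          · exact ⟨fun x hx => (nomatch hx), fun _ => Or.inr ⟨hc, ih.1 _ rfl⟩⟩
        · by_cases he : e = e₀
          · subst he
            rw [subdiv_joins_some_self] at hj
            rcases hj with ⟨rfl, rfl⟩ | ⟨rfl, rfl⟩
            · exact ⟨fun x hx => (nomatch hx), fun _ => Or.inl ⟨hc, ih.1 _ rfl⟩⟩
            · refine ⟨fun x hx => ?_, fun hn => absurd hn (Option.some_ne_none _)⟩
              cases hx
              rcases ih.2 rfl with ⟨-, hp⟩ | ⟨h2, hp⟩
              · exact hp
              · exact hp.tail ⟨e, (hH3 (hc.trans h2.symm)).symm, hc⟩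
          · rw [subdiv_joins_some_of_ne Z₁ e₀ he] at hj
            obtain ⟨x, y, rfl, rfl, hxy⟩ := hj
            refine ⟨fun x' hx' => ?_, fun hn => absurd hn (Option.some_ne_none _)⟩
            cases hx'
            exact (ih.1 x rfl).tail ⟨e, (hH1 e he x y).2 hxy, hc⟩
    exact (key _ h).1 v' rfl
  · intro h
    induction h with
    | refl => exact Relation.ReflTransGen.refl
    | tail hpath hstep ih =>
      rename_i x y
      obtain ⟨e, hj, hc⟩ := hstep
      by_cases he : e = e₀
      · subst he
        rcases hH2 x y hj with rfl | ⟨hagree, hxy⟩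
        · exact ih
        · rcases hxy with ⟨rfl, rfl⟩ | ⟨rfl, rfl⟩
          · -- `x = fst e₀`, `y = snd e₀`: through `none`
            exact (ih.tail ⟨some e, (subdiv_joins_some_self Z₁ e (some _) none).2 (Or.inl ⟨rfl, rfl⟩), hc⟩).tail
              ⟨none, (subdiv_joins_none Z₁ e none (some _)).2 (Or.inl ⟨rfl, rfl⟩), hagree.symm.trans hc⟩
          · -- `x = snd e₀`, `y = fst e₀`: through `none` the other way
            exact (ih.tail ⟨none, (subdiv_joins_none Z₁ e (some _) none).2 (Or.inr ⟨rfl, rfl⟩),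
              hagree.symm.trans hc⟩).tail
              ⟨some e, (subdiv_joins_some_self Z₁ e none (some _)).2 (Or.inr ⟨rfl, rfl⟩), hc⟩
      · exact ih.tail ⟨some e, (subdiv_joins_some_of_ne Z₁ e₀ he _ _).2 ⟨x, y, rfl, rfl, (hH1 e he x y).1 hj⟩, hc⟩

end Reach

/-! ## The statuses of old vertices -/

/-- `Mg` as a reflexive-transitive closure of the blue adjacency. -/
theorem Mg_iff_reflTransGen {V E T₁ T₂ : Type} (Z : ZoneData V E T₁ T₂) (k v : V) (ω : E → Bool) :
    Z.Mg k v ω ↔ Relation.ReflTransGen (cAdj Z false ω) k v := by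
  unfold Mg reach
  simp only [Set.mem_setOf_eq, Set.mem_singleton_iff, exists_eq_left]
  exact Iff.rfl

/-- `Rd` as a reflexive-transitive closure of the red adjacency. -/
theorem Rd_iff_reflTransGen {V E T₁ T₂ : Type} (Z : ZoneData V E T₁ T₂) (k v : V) (ω : E → Bool) :
    Z.Rd k v ω ↔ Relation.ReflTransGen (cAdj Z true ω) k v := by
  unfold Rd reach
  simp only [Set.mem_setOf_eq, Set.mem_singleton_iff, exists_eq_left]
  exact Iff.rfl

section Statuses

variable (ω' : Option E₁ → Bool)

/-- The two halves AGREE in colour: paths of the subdivided host between old vertices are paths of `Z₁`. -/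
theorem reflTransGen_subdiv_iff_agree (c : Bool) (h : ω' (some e₀) = ω' none) (v v' : V₁) :
    Relation.ReflTransGen (cAdj (subdiv Z₁ e₀) c ω') (some v) (some v') ↔
      Relation.ReflTransGen (cAdj Z₁ c fun e => ω' (some e)) v v' :=
  reflTransGen_subdiv_iff Z₁ e₀ c ω' Z₁ (fun _ _ _ _ => Iff.rfl) (fun _ _ hxy => Or.inr ⟨h, hxy⟩)
    (fun _ => Or.inl ⟨rfl, rfl⟩) v v'

/-- The two halves DISAGREE in colour: paths of the subdivided host between old vertices are paths of the
loopified host. -/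
theorem reflTransGen_subdiv_iff_disagree (c : Bool) (h : ω' (some e₀) ≠ ω' none) (v v' : V₁) :
    Relation.ReflTransGen (cAdj (subdiv Z₁ e₀) c ω') (some v) (some v') ↔
      Relation.ReflTransGen (cAdj (loopify Z₁ e₀) c fun e => ω' (some e)) v v' :=
  reflTransGen_subdiv_iff Z₁ e₀ c ω' (loopify Z₁ e₀) (fun _ he x y => loopify_joins_of_ne Z₁ e₀ he x y)
    (fun x y hxy => Or.inl (loopify_joins_self Z₁ e₀ x y hxy)) (fun hh => absurd hh h) v v'

/-- Merged status, halves agreeing. -/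
theorem Mg_subdiv_agree (h : ω' (some e₀) = ω' none) (v v' : V₁) :
    (subdiv Z₁ e₀).Mg (some v) (some v') ω' ↔ Z₁.Mg v v' fun e => ω' (some e) := by
  rw [Mg_iff_reflTransGen, Mg_iff_reflTransGen]
  exact reflTransGen_subdiv_iff_agree Z₁ e₀ ω' false h v v'

/-- Reached status, halves agreeing. -/
theorem Rd_subdiv_agree (h : ω' (some e₀) = ω' none) (v v' : V₁) :
    (subdiv Z₁ e₀).Rd (some v) (some v') ω' ↔ Z₁.Rd v v' fun e => ω' (some e) := by
  rw [Rd_iff_reflTransGen, Rd_iff_reflTransGen]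
  exact reflTransGen_subdiv_iff_agree Z₁ e₀ ω' true h v v'

/-- Merged status, halves disagreeing. -/
theorem Mg_subdiv_disagree (h : ω' (some e₀) ≠ ω' none) (v v' : V₁) :
    (subdiv Z₁ e₀).Mg (some v) (some v') ω' ↔ (loopify Z₁ e₀).Mg v v' fun e => ω' (some e) := by
  rw [Mg_iff_reflTransGen, Mg_iff_reflTransGen]
  exact reflTransGen_subdiv_iff_disagree Z₁ e₀ ω' false h v v'

/-- Reached status, halves disagreeing. -/
theorem Rd_subdiv_disagree (h : ω' (some e₀) ≠ ω' none) (v v' : V₁) :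
    (subdiv Z₁ e₀).Rd (some v) (some v') ω' ↔ (loopify Z₁ e₀).Rd v v' fun e => ω' (some e) := by
  rw [Rd_iff_reflTransGen, Rd_iff_reflTransGen]
  exact reflTransGen_subdiv_iff_disagree Z₁ e₀ ω' true h v v'

end Statuses

/-! ## The merged set, the blocks and the colouring terms -/

section Terms

variable {ι : Type} (u : ι → V₁) (a₁ : V₁) [Fintype ι] (ω' : Option E₁ → Bool)

/-- The merged set of the subdivided host, halves agreeing. -/
theorem merged_subdiv_agree (h : ω' (some e₀) = ω' none) :
    merged (subdiv Z₁ e₀) (fun k => some (u k)) (some a₁) ω' = merged Z₁ u a₁ fun e => ω' (some e) := by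
  ext k
  rw [mem_merged, mem_merged, Mg_subdiv_agree Z₁ e₀ ω' h]

/-- The blocks of the subdivided host, halves agreeing. -/
theorem blk_subdiv_agree (h : ω' (some e₀) = ω' none) :
    blk (subdiv Z₁ e₀) (fun k => some (u k)) (some a₁) ω' = blk Z₁ u a₁ fun e => ω' (some e) := by
  funext k
  ext l
  rw [mem_blk, mem_blk, Mg_subdiv_agree Z₁ e₀ ω' h, Mg_subdiv_agree Z₁ e₀ ω' h]

/-- The blocks of the subdivided host, halves agreeing. -/
theorem blocks_subdiv_agree (h : ω' (some e₀) = ω' none) :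
    blocks (subdiv Z₁ e₀) (fun k => some (u k)) (some a₁) ω' = blocks Z₁ u a₁ fun e => ω' (some e) := by
  ext B
  rw [mem_blocks, mem_blocks]
  simp only [Mg_subdiv_agree Z₁ e₀ ω' h, blk_subdiv_agree Z₁ e₀ u a₁ ω' h]

/-- The merged set of the subdivided host, halves disagreeing. -/
theorem merged_subdiv_disagree (h : ω' (some e₀) ≠ ω' none) :
    merged (subdiv Z₁ e₀) (fun k => some (u k)) (some a₁) ω' = merged (loopify Z₁ e₀) u a₁ fun e => ω' (some e) := by
  ext k
  rw [mem_merged, mem_merged, Mg_subdiv_disagree Z₁ e₀ ω' h]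

/-- The blocks of the subdivided host, halves disagreeing. -/
theorem blk_subdiv_disagree (h : ω' (some e₀) ≠ ω' none) :
    blk (subdiv Z₁ e₀) (fun k => some (u k)) (some a₁) ω' = blk (loopify Z₁ e₀) u a₁ fun e => ω' (some e) := by
  funext k
  ext l
  rw [mem_blk, mem_blk, Mg_subdiv_disagree Z₁ e₀ ω' h, Mg_subdiv_disagree Z₁ e₀ ω' h]

/-- The blocks of the subdivided host, halves disagreeing. -/
theorem blocks_subdiv_disagree (h : ω' (some e₀) ≠ ω' none) :
    blocks (subdiv Z₁ e₀) (fun k => some (u k)) (some a₁) ω' =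
      blocks (loopify Z₁ e₀) u a₁ fun e => ω' (some e) := by
  ext B
  rw [mem_blocks, mem_blocks]
  simp only [Mg_subdiv_disagree Z₁ e₀ ω' h, blk_subdiv_disagree Z₁ e₀ u a₁ ω' h]

/-- **The colouring term of the subdivided host, halves agreeing**, is the colouring term of `Z₁`. -/
theorem colTerm_subdiv_agree (h : ω' (some e₀) = ω' none) (w : ι → Vec6) :
    colTerm (subdiv Z₁ e₀) (fun k => some (u k)) (some a₁) ω' w = colTerm Z₁ u a₁ (fun e => ω' (some e)) w := by
  unfold colTerm
  rw [merged_subdiv_agree Z₁ e₀ u a₁ ω' h, blocks_subdiv_agree Z₁ e₀ u a₁ ω' h]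
  simp only [Rd_subdiv_agree Z₁ e₀ ω' h]

/-- **The colouring term of the subdivided host, halves disagreeing**, is the colouring term of the loopified
host. -/
theorem colTerm_subdiv_disagree (h : ω' (some e₀) ≠ ω' none) (w : ι → Vec6) :
    colTerm (subdiv Z₁ e₀) (fun k => some (u k)) (some a₁) ω' w =
      colTerm (loopify Z₁ e₀) u a₁ (fun e => ω' (some e)) w := by
  unfold colTerm
  rw [merged_subdiv_disagree Z₁ e₀ u a₁ ω' h, blocks_subdiv_disagree Z₁ e₀ u a₁ ω' h]
  simp only [Rd_subdiv_disagree Z₁ e₀ ω' h]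

end Terms

/-! ## THEOREM (SUBDIVISION) -/

/-- A colouring of the subdivided host from a colouring `ω` of `Z₁` and the colour `b` of the new half-edge. -/
def extCol (ω : E₁ → Bool) (b : Bool) : Option E₁ → Bool := fun e => e.elim b ω

/-- The colourings of the subdivided host are the pairs (colouring of `Z₁`, colour of the new half-edge). -/
def extColEquiv : (E₁ → Bool) × Bool ≃ (Option E₁ → Bool) where
  toFun p := extCol p.1 p.2
  invFun ω' := (fun e => ω' (some e), ω' none)
  left_inv p := rfl
  right_inv ω' := by
    funext e
    cases e <;> rfl

section Main

variable {ι : Type} (u : ι → V₁) (a₁ : V₁) [Fintype ι] [Fintype E₁]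

omit [Fintype E₁] in
/-- Summing the colouring terms over the colour of the new half-edge: the term of `Z₁` plus the term of the
loopified host. -/
theorem sum_bool_colTerm_extCol (ω : E₁ → Bool) (w : ι → Vec6) :
    ∑ b : Bool, colTerm (subdiv Z₁ e₀) (fun k => some (u k)) (some a₁) (extCol ω b) w =
      colTerm Z₁ u a₁ ω w + colTerm (loopify Z₁ e₀) u a₁ ω w := by
  rw [Fintype.sum_bool]
  cases hb : ω e₀
  · rw [colTerm_subdiv_disagree Z₁ e₀ u a₁ _ (by simpa [extCol] using hb) w,
      colTerm_subdiv_agree Z₁ e₀ u a₁ _ (by simpa [extCol] using hb) w, add_comm]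
    rfl
  · rw [colTerm_subdiv_agree Z₁ e₀ u a₁ _ (by simpa [extCol] using hb) w,
      colTerm_subdiv_disagree Z₁ e₀ u a₁ _ (by simpa [extCol] using hb) w]
    rfl

/-- **THEOREM (SUBDIVISION)**: the block map of the host with `e₀` subdivided (exits `some ∘ u`, anchor
`some a₁`) is the block map of the host plus the block map of the host with `e₀` turned into a loop. -/
theorem blockMap_subdiv (w : ι → Vec6) :
    blockMap (subdiv Z₁ e₀) (fun k => some (u k)) (some a₁) w =
      blockMap Z₁ u a₁ w + blockMap (loopify Z₁ e₀) u a₁ w := by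
  rw [blockMap_eq_sum_colTerm, blockMap_eq_sum_colTerm, blockMap_eq_sum_colTerm, ← Finset.sum_add_distrib,
    ← Fintype.sum_equiv (extColEquiv (E₁ := E₁))
      (fun p => colTerm (subdiv Z₁ e₀) (fun k => some (u k)) (some a₁) (extColEquiv p) w) _ (fun _ => rfl),
    Fintype.sum_prod_type]
  exact Finset.sum_congr rfl fun ω _ => sum_bool_colTerm_extCol Z₁ e₀ u a₁ ω w

/-- **The cone conjecture for block maps is closed under subdivision**: if the block maps of `Z₁` and of the
loopified host send the family `w` into the cone, so does the block map of the subdivided host. -/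
theorem inCone_blockMap_subdiv (w : ι → Vec6) (h₁ : InCone (blockMap Z₁ u a₁ w))
    (h₂ : InCone (blockMap (loopify Z₁ e₀) u a₁ w)) :
    InCone (blockMap (subdiv Z₁ e₀) (fun k => some (u k)) (some a₁) w) := by
  rw [blockMap_subdiv]
  exact h₁.add h₂

end Main

end MultiExit

end ZoneZ

end PercRepro
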